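import Summits.NavierStokesRegularity.NavierStokesRegularity.Theorems.CertifiedBlowupCertifiedBlowupAxisymBlowupSwirlOrderParameter
import Summits.NavierStokesRegularity.NavierStokesRegularity.Theorems.CertifiedBlowupCertifiedBlowupAxisymBlowupNormalForm
import Summits.NavierStokesRegularity.NavierStokesRegularity.Theorems.CertifiedBlowupCertifiedBlowupAxisymBlowupSwirlNumber
import HarnessLib

/-!
# Crux `CertifiedBlowupAxisymBlowup` (stmt-NavierStokesRegularity-0727): structure of the set of swirl Reynolds numbers

Summit `NavierStokesRegularity`, thesis `CertifiedBlowup`, crux `CertifiedBlowupAxisymBlowup`.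
Theorems file landed `--supports stmt-NavierStokesRegularity-0727` for line `compact-amplification`
(continuation lead c3, wave 2; stub `swirlNumberSet_structure`, bet route `SwirlThreshold`).

Route `SwirlThreshold` organises the axisymmetric-with-swirl blow-up problem by the order parameter
`M_u(t) = sup_x |Γ(u(t), x)|`, `Γ = r u_θ = x₀ u₁ − x₁ u₀` the swirl (KNSS 2009, (1.8); Lei–Zhang
2017, §1: `Γ` is scaling critical and obeys the maximum principle), and by its threshold
`Re_c := inf S(ν)`, where
`S(ν) = { sup_x |Γ(u(t), x)| / ν : (T, u, p) a witness of the crux at viscosity ν, t ∈ [0, T) }`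
is the set of swirl Reynolds numbers realised by witnesses of the crux (maximal classical solution
on `[0, T)`, Leray–Hopf from a rapidly decaying axisymmetric datum). By the landed
`swirlNumberSet_eq` the set `S(ν)` does not depend on `ν`, so `Re_c` is a pure number. This file
proves, kernel-checked, the structure of `S(ν)` short of defining `Re_c`
(`swirlNumberSet_structure`, registered stub), for every `ν > 0`:

* `S(ν)` is nonempty iff the crux `CertifiedBlowupAxisymBlowup` holds (`→`: a member carries a
  witness at viscosity `ν`; `←`: the landed normal form `certifiedBlowupAxisymBlowup_iff_forall_nu_T`
  gives a witness at THIS `ν` with `T = 1`, whose slice `t = 0` realises a member) — so that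
  `Re_c < ∞ ↔` the crux under the convention `inf ∅ = ∞`;
* every member of `S(ν)` is positive (`M_u(t) > 0` on `[0, T)`,
  `swirlSup_pos_strictAntiOn_of_isMaximalSmoothSolution`);
* `S(ν)` has no least element: a member realised by `(T, u, p)` at time `t` is undercut by the
  later slice `t' = (t + T)/2` of the SAME witness, by the strict decrease of `M_u` on `[0, T)`
  (`swirlSup_pos_strictAntiOn_of_isMaximalSmoothSolution`) — hence the infimum `Re_c` is never
  attained and `sup_x |Γ| > ν · Re_c` at every instant of every witness.

No new definitions, no named-fact hypotheses, no `sorry`.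

## References

* Z. Lei, Q. S. Zhang, *Criticality of the axially symmetric Navier–Stokes equations*, Pacific J.
  Math. 289 (2017), §1 (criticality of `Γ`, maximum principle). [LeiZhang2017]
* G. Koch, N. Nadirashvili, G. Seregin, V. Šverák, *Liouville theorems for the Navier–Stokes
  equations and applications*, Acta Math. 203 (2009), Lemma 2.1 and (1.8). [KNSS2009]
* D. Chae, J. Lee, *On the regularity of the axisymmetric solutions of the Navier–Stokes
  equations*, Math. Z. 239 (2002). [ChaeLee2002]
-/

-- the summit and its single problem share the name (D-0017 nested layout)
set_option linter.dupNamespace false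

noncomputable section

open MeasureTheory Set Function Filter Topology Metric
open scoped ENNReal NNReal

namespace Summit.NavierStokesRegularity.NavierStokesRegularity.Theorems.CertifiedBlowupAxisymBlowup.CompactAmplification

open Literature.Analysis.FluidPDE

/-! ### Members of `S(ν)` from a witness, and the later slice of the same witness -/

/-- **A slice of a witness realises a swirl Reynolds number**: if `(T, u, p)` is a witness of the
crux at viscosity `ν` and `t ∈ [0, T)`, then `sup_x |Γ(u(t), x)| / ν ∈ S(ν)` (by definition of the
set of swirl Reynolds numbers; KNSS 2009, (1.8)). [cite: KNSS2009, (1.8)] -/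
theorem swirlNumber_mem_of_isMaximalSmoothSolution {ν T : ℝ}
    {u : ℝ → EuclideanSpace ℝ (Fin 3) → EuclideanSpace ℝ (Fin 3)}
    {p : ℝ → EuclideanSpace ℝ (Fin 3) → ℝ} (hT : 0 < T) (hmax : IsMaximalSmoothSolution ν 0 u p T)
    (hLH : IsLerayHopfOn T ν 0 (u 0) u) (hdec : HasRapidSpatialDecay (u 0))
    (hax : IsAxisymmetric (u 0)) {t : ℝ} (ht : t ∈ Set.Ico 0 T) :
    sSup (Set.range fun x => |swirl (u t) x|) / ν ∈
      {R : ℝ | ∃ (T : ℝ) (u : ℝ → EuclideanSpace ℝ (Fin 3) → EuclideanSpace ℝ (Fin 3))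
        (p : ℝ → EuclideanSpace ℝ (Fin 3) → ℝ), 0 < T ∧ IsMaximalSmoothSolution ν 0 u p T ∧
        IsLerayHopfOn T ν 0 (u 0) u ∧ HasRapidSpatialDecay (u 0) ∧ IsAxisymmetric (u 0) ∧
        ∃ t ∈ Set.Ico 0 T, R = sSup (Set.range fun x => |swirl (u t) x|) / ν} :=
  ⟨T, u, p, hT, hmax, hLH, hdec, hax, t, ht, rfl⟩

/-- **Every swirl Reynolds number of a witness is positive**: for a witness `(T, u, p)` of the crux
at viscosity `ν > 0` and `t ∈ [0, T)`, `sup_x |Γ(u(t), x)| / ν > 0` — the swirl of a witness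
vanishes identically at no time (no-swirl solutions are global) and `sup_x |Γ(u(t), x)|` is a finite
positive number (Lei–Zhang 2017, §1). [cite: LeiZhang2017, §1 (criticality of Γ, maximum principle)] -/
theorem swirlNumber_pos_of_isMaximalSmoothSolution {ν T : ℝ}
    {u : ℝ → EuclideanSpace ℝ (Fin 3) → EuclideanSpace ℝ (Fin 3)}
    {p : ℝ → EuclideanSpace ℝ (Fin 3) → ℝ} (hν : 0 < ν) (hT : 0 < T)
    (hmax : IsMaximalSmoothSolution ν 0 u p T) (hLH : IsLerayHopfOn T ν 0 (u 0) u)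
    (hdec : HasRapidSpatialDecay (u 0)) (hax : IsAxisymmetric (u 0)) {t : ℝ}
    (ht : t ∈ Set.Ico 0 T) : 0 < sSup (Set.range fun x => |swirl (u t) x|) / ν :=
  div_pos ((swirlSup_pos_strictAntiOn_of_isMaximalSmoothSolution hν hT hmax hLH hdec hax).1 t ht).2
    hν

/-- **The later slice undercuts**: for a witness `(T, u, p)` of the crux at viscosity `ν > 0` and
`t ∈ [0, T)`, the midpoint `t' = (t + T)/2 ∈ [0, T)` of `[t, T)` realises a strictly smaller swirl
Reynolds number, `sup_x |Γ(u(t'), x)| / ν < sup_x |Γ(u(t), x)| / ν`, by the strict decrease of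
`t ↦ sup_x |Γ(u(t), x)|` on `[0, T)` (strong maximum principle for `Γ`; Lei–Zhang 2017, §1;
KNSS 2009, Lemma 2.1). [cite: LeiZhang2017, §1 (criticality of Γ, maximum principle)] -/
theorem swirlNumber_midpoint_lt_of_isMaximalSmoothSolution {ν T : ℝ}
    {u : ℝ → EuclideanSpace ℝ (Fin 3) → EuclideanSpace ℝ (Fin 3)}
    {p : ℝ → EuclideanSpace ℝ (Fin 3) → ℝ} (hν : 0 < ν) (hT : 0 < T)
    (hmax : IsMaximalSmoothSolution ν 0 u p T) (hLH : IsLerayHopfOn T ν 0 (u 0) u)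
    (hdec : HasRapidSpatialDecay (u 0)) (hax : IsAxisymmetric (u 0)) {t : ℝ}
    (ht : t ∈ Set.Ico 0 T) :
    (t + T) / 2 ∈ Set.Ico 0 T ∧
      sSup (Set.range fun x => |swirl (u ((t + T) / 2)) x|) / ν <
        sSup (Set.range fun x => |swirl (u t) x|) / ν := by
  have ht' : (t + T) / 2 ∈ Set.Ico 0 T := ⟨by linarith [ht.1, ht.2], by linarith [ht.2]⟩
  have htt' : t < (t + T) / 2 := by linarith [ht.2]
  exact ⟨ht', div_lt_div_of_pos_right
    ((swirlSup_pos_strictAntiOn_of_isMaximalSmoothSolution hν hT hmax hLH hdec hax).2 ht ht' htt')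
    hν⟩

/-! ### The registered stub -/

/-- **Structure of the set of swirl Reynolds numbers** (registered stub of
stmt-NavierStokesRegularity-0727, line `compact-amplification`, route `SwirlThreshold`, kernel form
of its (T1) short of defining `Re_c := inf S(ν)`): for every viscosity `ν > 0`, the set `S(ν)` of
swirl Reynolds numbers `sup_x |Γ(u(t), x)| / ν` (`Γ = r u_θ = x₀ u₁ − x₁ u₀`, KNSS 2009, (1.8))
realised at times `t ∈ [0, T)` by witnesses `(T, u, p)` of the crux `CertifiedBlowupAxisymBlowup`
at viscosity `ν` (i) is nonempty iff the crux holds (a member carries a witness; conversely the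
normal form `certifiedBlowupAxisymBlowup_iff_forall_nu_T` supplies a witness at this `ν`, `T = 1`,
whose initial slice realises a member), (ii) consists of positive numbers, and (iii) has no least
element — the later slice `(t + T)/2` of the same witness realises a strictly smaller number by the
strict decrease of `sup_x |Γ|` (maximum principle for `Γ`, Lei–Zhang 2017, §1; KNSS 2009,
Lemma 2.1). Hence `Re_c = inf S(ν)` (a pure number by `swirlNumberSet_eq`) is finite iff the crux,
is never attained, and `sup_x |Γ(u(t), x)| > ν · Re_c` at every instant of every witness.
[cite: LeiZhang2017, §1 (criticality of Γ, maximum principle)] -/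
theorem swirlNumberSet_structure : ∀ ν : ℝ, 0 < ν → ({R : ℝ | ∃ (T : ℝ) (u : ℝ → EuclideanSpace ℝ (Fin 3) → EuclideanSpace ℝ (Fin 3)) (p : ℝ → EuclideanSpace ℝ (Fin 3) → ℝ), 0 < T ∧ IsMaximalSmoothSolution ν 0 u p T ∧ IsLerayHopfOn T ν 0 (u 0) u ∧ HasRapidSpatialDecay (u 0) ∧ IsAxisymmetric (u 0) ∧ ∃ t ∈ Set.Ico 0 T, R = sSup (Set.range fun x => |swirl (u t) x|) / ν}.Nonempty ↔ Summit.NavierStokesRegularity.NavierStokesRegularity.Theses.CertifiedBlowup.CertifiedBlowupAxisymBlowup) ∧ (∀ R ∈ {R : ℝ | ∃ (T : ℝ) (u : ℝ → EuclideanSpace ℝ (Fin 3) → EuclideanSpace ℝ (Fin 3)) (p : ℝ → EuclideanSpace ℝ (Fin 3) → ℝ), 0 < T ∧ IsMaximalSmoothSolution ν 0 u p T ∧ IsLerayHopfOn T ν 0 (u 0) u ∧ HasRapidSpatialDecay (u 0) ∧ IsAxisymmetric (u 0) ∧ ∃ t ∈ Set.Ico 0 T, R = sSup (Set.range fun x =>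 |swirl (u t) x|) / ν}, 0 < R) ∧ ∀ R ∈ {R : ℝ | ∃ (T : ℝ) (u : ℝ → EuclideanSpace ℝ (Fin 3) → EuclideanSpace ℝ (Fin 3)) (p : ℝ → EuclideanSpace ℝ (Fin 3) → ℝ), 0 < T ∧ IsMaximalSmoothSolution ν 0 u p T ∧ IsLerayHopfOn T ν 0 (u 0) u ∧ HasRapidSpatialDecay (u 0) ∧ IsAxisymmetric (u 0) ∧ ∃ t ∈ Set.Ico 0 T, R = sSup (Set.range fun x => |swirl (u t) x|) / ν}, ∃ R' ∈ {R : ℝ | ∃ (T : ℝ) (u : ℝ → EuclideanSpace ℝ (Fin 3) → EuclideanSpace ℝ (Fin 3)) (p : ℝ → EuclideanSpace ℝ (Fin 3) → ℝ), 0 < T ∧ IsMaximalSmoothSolution ν 0 u p T ∧ IsLerayHopfOn T ν 0 (u 0) u ∧ HasRapidSpatialDecay (u 0) ∧ IsAxisymmetric (u 0) ∧ ∃ t ∈ Set.Ico 0 T, R = sSup (Set.range fun x => |swirl (u t) x|) / ν}, R' < R := by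
  intro ν hν
  refine ⟨⟨?_, ?_⟩, ?_, ?_⟩
  · -- (i, →): a member is realised by a witness `(T, u, p)` at viscosity `ν`, i.e. the crux.
    rintro ⟨R, T, u, p, hT, hmax, hLH, hdec, hax, -⟩
    unfold Summit.NavierStokesRegularity.NavierStokesRegularity.Theses.CertifiedBlowup.CertifiedBlowupAxisymBlowup
    exact ⟨ν, hν, T, hT, u, p, hmax, hLH, hdec, hax⟩
  · -- (i, ←): the normal form gives a witness at this `ν` with `T = 1`; its slice `t = 0`.
    intro h
    obtain ⟨u, p, hmax, hLH, hdec, hax⟩ :=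
      certifiedBlowupAxisymBlowup_iff_forall_nu_T.1 h ν hν 1 one_pos
    exact ⟨_, swirlNumber_mem_of_isMaximalSmoothSolution one_pos hmax hLH hdec hax
      (t := 0) ⟨le_rfl, one_pos⟩⟩
  · -- (ii): positivity of the swirl supremum of a witness.
    rintro R ⟨T, u, p, hT, hmax, hLH, hdec, hax, t, ht, rfl⟩
    exact swirlNumber_pos_of_isMaximalSmoothSolution hν hT hmax hLH hdec hax ht
  · -- (iii): the later slice `(t + T)/2` of the same witness undercuts.
    rintro R ⟨T, u, p, hT, hmax, hLH, hdec, hax, t, ht, rfl⟩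
    obtain ⟨ht', hlt⟩ := swirlNumber_midpoint_lt_of_isMaximalSmoothSolution hν hT hmax hLH hdec hax ht
    exact ⟨_, swirlNumber_mem_of_isMaximalSmoothSolution hT hmax hLH hdec hax ht', hlt⟩

end Summit.NavierStokesRegularity.NavierStokesRegularity.Theorems.CertifiedBlowupAxisymBlowup.CompactAmplification

end
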